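import Summits.QuantumFields.YangMills.Theorems.BalabanLadderNTClassicalShadowOrbitSoftClosure
import HarnessLib

/-!
# Crux `NT` (stmt-QuantumFields-19353), stub `stub_refpkgT : RefPkgT`: THE CLASSICAL SHADOW, XVI — the ENERGY-CERTIFICATE form of the
# δ-robust orbit test: a trial energy and a sublevel dichotomy replace every statement about ground states

Helper file (`--supports stmt-QuantumFields-19353`) of the fleet lead prover of crux `NT` (unit `ym-spine-19353-p1`, GEN 16); sequel of
`…ClassicalShadowOrbitSoftClosure` (this generation).

WHY.  The δ-robust orbit test (`orbitCov_le_of_e2osc_nearOrbit`) asks: every GROUND STATE of the frustrated box is δ-close, in two densities seen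
through the symmetry family, to the orbit of ONE configuration `A`.  Ground states are never in hand; what a certified computation (interval
branch-and-bound) or a hand estimate can deliver is a statement about a SUBLEVEL set of the boundary Wilson action: a trial interior configuration
`ζ₀` (its energy is finite arithmetic) and the dichotomy «every interior configuration of energy `≤ E(ζ₀)` is δ-close to the orbit of `A`».  Since the
ground states lie in every non-empty sublevel set, that CERTIFICATE implies the hypothesis of the orbit test:

* §1 `cubeMinimisers_subset_sublevel` — `GS(η) ⊆ {ζ | E_η(ζ) ≤ E_η(ζ₀)}` for every `ζ₀`; `nearOrbit_of_certificate` — trial + sublevel dichotomy ⇒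
  the near-orbit hypothesis `hGS` of `…OrbitSoftClosure` (also in the split form: a number `m` with `E_η(ζ₀) ≤ m` and the dichotomy below `m`);
* §2 **`orbitCov_le_of_e2osc_certificate`** — clause 2 (depth `≥ 1`) + kernel symmetries + certificate ⇒
  `|Cov_Γ(A; x, y)| − 24N·δ ≤ C₂ / min(d_x,d_y)⁴ / (1 + ‖y − x‖)⁴`; **`zeroTempCovFloorUnbounded_of_certificates`** — a family of certified boxes with
  `|Cov_Γ(A_b)| > c₀ + 24N·δ_b` at unbounded separation ⇒ `ZeroTempCovFloorUnbounded G r` (⇒ `¬` clause 2 at `(G, r)` for every unit).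

So a kernel-checkable refutation of the registered clause 2 at an instance `(G, r)` now has the shape: per box `b`, (a) the finite symmetry family with its
three tree-supplied properties, (b) ONE configuration `A_b` with the orbit covariance of its density field (finite arithmetic), (c) ONE trial interior
configuration (finite arithmetic), (d) a certified lower bound: no interior configuration below the trial energy is farther than `δ_b` from the orbit —
the only analytic / computational burden; and (e) `b → ∞`.

HONEST FRAMING.  Plumbing over the registered clauses at fixed lattice geometry; the certificates are HYPOTHESES; nothing here asserts that any box
carries one; no floor, not AF, not NT, not the seam, not the gap; not Clay.
-/

set_option autoImplicit false

noncomputable section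

open MeasureTheory Filter Topology
open Literature.MathematicalPhysics.QuantumFieldTheory Literature.MathematicalPhysics.QuantumLattice
open Literature.Probability.LatticeModels
open Summit.QuantumFields.YangMills.Cruxes.OSLegsFromFemtoAndGap.DlrCollarTransfer
open Summit.QuantumFields.YangMills.Cruxes.UVSeamRec.BoundaryLawPenetration

namespace Summit.QuantumFields.YangMills.Cruxes.NT.ClassicalShadow

variable {G : Type} [Group G] [TopologicalSpace G] [IsTopologicalGroup G] [CompactSpace G]
  [MeasurableSpace G] [BorelSpace G] (r : LatticeRep G)

/-! ## §1 Ground states lie in every sublevel set -/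

section Sublevel

variable (c : Fin 4 → ℤ) (b : ℕ) (η : LGConfig 4 G)

omit [IsTopologicalGroup G] [CompactSpace G] [MeasurableSpace G] [BorelSpace G] in
/-- **Ground states lie below every trial energy**: `GS(η) ⊆ {ζ | E_η(ζ) ≤ E_η(ζ₀)}`. [folklore] -/
theorem cubeMinimisers_subset_sublevel (ζ₀ : ↥(cubeEdges c b) → G) :
    cubeMinimisers G r c b η ⊆ {ζ | wilsonBoundaryAction r.ρ (cubeEdges c b) (glueWith (cubeEdges c b) ζ η) ≤
      wilsonBoundaryAction r.ρ (cubeEdges c b) (glueWith (cubeEdges c b) ζ₀ η)} :=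
  fun _ hζ => hζ ζ₀

omit [IsTopologicalGroup G] [CompactSpace G] [MeasurableSpace G] [BorelSpace G] in
/-- **Certificate ⇒ near-orbit hypothesis.**  A trial interior configuration `ζ₀` with energy `≤ m` and the dichotomy «every interior configuration of
energy `≤ m` satisfies `P`» give `P` on every ground state. [folklore] -/
theorem forall_cubeMinimisers_of_certificate {P : (↥(cubeEdges c b) → G) → Prop} {m : ℝ} (ζ₀ : ↥(cubeEdges c b) → G)
    (htrial : wilsonBoundaryAction r.ρ (cubeEdges c b) (glueWith (cubeEdges c b) ζ₀ η) ≤ m)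
    (hdich : ∀ ζ : ↥(cubeEdges c b) → G, wilsonBoundaryAction r.ρ (cubeEdges c b) (glueWith (cubeEdges c b) ζ η) ≤ m → P ζ) :
    ∀ ζ ∈ cubeMinimisers G r c b η, P ζ :=
  fun ζ hζ => hdich ζ ((hζ ζ₀).trans htrial)

variable {ι : Type}

/-- **Certificate ⇒ δ-closeness of the ground states to the orbit of `A`** (the hypothesis `hGS` of `…OrbitSoftClosure`, two sites). [folklore] -/
theorem nearOrbit_of_certificate (γ : ι → LGConfig 4 G → LGConfig 4 G) (A : LGConfig 4 G) (x y : Fin 4 → ℤ) {δ m : ℝ}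
    (ζ₀ : ↥(cubeEdges c b) → G) (htrial : wilsonBoundaryAction r.ρ (cubeEdges c b) (glueWith (cubeEdges c b) ζ₀ η) ≤ m)
    (hdich : ∀ ζ : ↥(cubeEdges c b) → G, wilsonBoundaryAction r.ρ (cubeEdges c b) (glueWith (cubeEdges c b) ζ η) ≤ m →
      ∃ (j : ι) (g : Site 4 → G), ∀ i,
        |dens G r x (γ i (glueWith (cubeEdges c b) ζ η)) - dens G r x (γ i (gaugeTransformZd g (γ j A)))| ≤ δ ∧
        |dens G r y (γ i (glueWith (cubeEdges c b) ζ η)) - dens G r y (γ i (gaugeTransformZd g (γ j A)))| ≤ δ) :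
    ∀ ζ ∈ cubeMinimisers G r c b η, ∃ (j : ι) (g : Site 4 → G), ∀ i,
      |dens G r x (γ i (glueWith (cubeEdges c b) ζ η)) - dens G r x (γ i (gaugeTransformZd g (γ j A)))| ≤ δ ∧
      |dens G r y (γ i (glueWith (cubeEdges c b) ζ η)) - dens G r y (γ i (gaugeTransformZd g (γ j A)))| ≤ δ :=
  forall_cubeMinimisers_of_certificate r c b η ζ₀ htrial hdich

end Sublevel

/-! ## §2 The certificate form of the δ-robust orbit test -/

section Certificate

variable (a : ℝ → ℝ) {ι : Type} [Fintype ι] [Nonempty ι]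

/-- **Clause 2, certificate form.**  Clause 2 of the registered package (depth `≥ 1`, unit `a → 0`, `ℓ > 0`, constant `C₂`), a finite kernel-symmetric
family `γ` closed up to re-indexing and gauge and normalising the gauge group, ONE configuration `A`, ONE trial interior configuration `ζ₀` with energy
`≤ m`, and the sublevel dichotomy «every interior configuration of energy `≤ m` is δ-close to the orbit of `A` in the densities at `x, y`» ⇒
`|Cov_Γ(A; x, y)| − 24N·δ ≤ C₂ / min(d_x,d_y)⁴ / (1 + ‖y − x‖)⁴`. [folklore] -/
theorem orbitCov_le_of_e2osc_certificate (ha0 : Tendsto a atTop (𝓝 0)) {C₂ ℓ : ℝ} (hℓ : 0 < ℓ)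
    (hE2 : ∃ β₂ : ℝ, ∀ β : ℝ, β₂ ≤ β → ∀ (c : Fin 4 → ℤ) (b : ℕ), (b : ℝ) * a β ≤ ℓ →
      ∀ (η η' : LGConfig 4 G) (x y : Fin 4 → ℤ), 1 ≤ depth c b x → 1 ≤ depth c b y →
        |kerCov G r β c b η (dens G r x) (dens G r y) - kerCov G r β c b η' (dens G r x) (dens G r y)| ≤
          C₂ / ((min (depth c b x) (depth c b y) : ℕ) : ℝ) ^ 4 / (1 + ‖siteToE (y - x)‖) ^ 4)
    (c : Fin 4 → ℤ) (b : ℕ) (η : LGConfig 4 G) (γ : ι → LGConfig 4 G → LGConfig 4 G) (hγ : ∀ i, Continuous (γ i))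
    (hmul : ∀ j : ι, ∃ e : ι ≃ ι, ∀ (k : ι) (U : LGConfig 4 G), ∃ h : Site 4 → G, γ k (γ j U) = gaugeTransformZd h (γ (e k) U))
    (hgauge : ∀ (i : ι) (g : Site 4 → G), ∃ g' : Site 4 → G, ∀ U : LGConfig 4 G, γ i (gaugeTransformZd g U) = gaugeTransformZd g' (γ i U))
    (hsymm : ∀ (β : ℝ) (i : ι) (F : LGConfig 4 G → ℝ), Continuous F → kerE G r β c b η (F ∘ γ i) = kerE G r β c b η F)
    (A : LGConfig 4 G) {x y : Fin 4 → ℤ} (hx : 1 ≤ depth c b x) (hy : 1 ≤ depth c b y) {δ m : ℝ}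
    (ζ₀ : ↥(cubeEdges c b) → G) (htrial : wilsonBoundaryAction r.ρ (cubeEdges c b) (glueWith (cubeEdges c b) ζ₀ η) ≤ m)
    (hdich : ∀ ζ : ↥(cubeEdges c b) → G, wilsonBoundaryAction r.ρ (cubeEdges c b) (glueWith (cubeEdges c b) ζ η) ≤ m →
      ∃ (j : ι) (g : Site 4 → G), ∀ i,
        |dens G r x (γ i (glueWith (cubeEdges c b) ζ η)) - dens G r x (γ i (gaugeTransformZd g (γ j A)))| ≤ δ ∧
        |dens G r y (γ i (glueWith (cubeEdges c b) ζ η)) - dens G r y (γ i (gaugeTransformZd g (γ j A)))| ≤ δ) :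
    |(∑ i, dens G r x (γ i A) * dens G r y (γ i A)) / Fintype.card ι -
          (∑ i, dens G r x (γ i A)) / Fintype.card ι * ((∑ i, dens G r y (γ i A)) / Fintype.card ι)| - 24 * r.N * δ ≤
      C₂ / ((min (depth c b x) (depth c b y) : ℕ) : ℝ) ^ 4 / (1 + ‖siteToE (y - x)‖) ^ 4 :=
  orbitCov_le_of_e2osc_nearOrbit r a ha0 hℓ hE2 c b η γ hγ hmul hgauge hsymm A hx hy
    (nearOrbit_of_certificate r c b η γ A x y ζ₀ htrial hdich)

/-- **Certified family ⇒ unbounded zero-temperature floor ⇒ `¬` clause 2 at `(G, r)`.**  For every `n`: a box, an exterior, a finite symmetry family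
(kernel-symmetric, closed up to gauge, normalising), ONE configuration `A`, two cube sites at separation `≥ n`, a tolerance `δ`, a trial interior
configuration `ζ₀` with energy `≤ m` and the sublevel dichotomy below `m`, with `c₀ + 24N·δ < |Cov_Γ(A; x, y)|`.  Then `ZeroTempCovFloorUnbounded G r`.
[folklore] -/
theorem zeroTempCovFloorUnbounded_of_certificates {c₀ : ℝ} (hc₀ : 0 < c₀)
    (h : ∀ n : ℕ, ∃ (c : Fin 4 → ℤ) (b : ℕ) (η : LGConfig 4 G) (γ : ι → LGConfig 4 G → LGConfig 4 G) (A : LGConfig 4 G)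
      (x y : Fin 4 → ℤ) (δ m : ℝ) (ζ₀ : ↥(cubeEdges c b) → G),
      (∀ i, Continuous (γ i)) ∧
      (∀ j : ι, ∃ e : ι ≃ ι, ∀ (k : ι) (U : LGConfig 4 G), ∃ h : Site 4 → G, γ k (γ j U) = gaugeTransformZd h (γ (e k) U)) ∧
      (∀ (i : ι) (g : Site 4 → G), ∃ g' : Site 4 → G, ∀ U : LGConfig 4 G, γ i (gaugeTransformZd g U) = gaugeTransformZd g' (γ i U)) ∧
      (∀ (β : ℝ) (i : ι) (F : LGConfig 4 G → ℝ), Continuous F → kerE G r β c b η (F ∘ γ i) = kerE G r β c b η F) ∧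
      1 ≤ depth c b x ∧ 1 ≤ depth c b y ∧ (n : ℝ) ≤ ‖siteToE (y - x)‖ ∧
      wilsonBoundaryAction r.ρ (cubeEdges c b) (glueWith (cubeEdges c b) ζ₀ η) ≤ m ∧
      (∀ ζ : ↥(cubeEdges c b) → G, wilsonBoundaryAction r.ρ (cubeEdges c b) (glueWith (cubeEdges c b) ζ η) ≤ m →
        ∃ (j : ι) (g : Site 4 → G), ∀ i,
          |dens G r x (γ i (glueWith (cubeEdges c b) ζ η)) - dens G r x (γ i (gaugeTransformZd g (γ j A)))| ≤ δ ∧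
          |dens G r y (γ i (glueWith (cubeEdges c b) ζ η)) - dens G r y (γ i (gaugeTransformZd g (γ j A)))| ≤ δ) ∧
      c₀ + 24 * r.N * δ < |(∑ i, dens G r x (γ i A) * dens G r y (γ i A)) / Fintype.card ι -
          (∑ i, dens G r x (γ i A)) / Fintype.card ι * ((∑ i, dens G r y (γ i A)) / Fintype.card ι)|) :
    ZeroTempCovFloorUnbounded G r := by
  refine zeroTempCovFloorUnbounded_of_nearOrbit (ι := ι) r hc₀ fun n => ?_
  obtain ⟨c, b, η, γ, A, x, y, δ, m, ζ₀, hγ, hmul, hgauge, hsymm, hx, hy, hsep, htrial, hdich, hgap⟩ := h n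
  exact ⟨c, b, η, γ, A, x, y, δ, hγ, hmul, hgauge, hsymm, hx, hy, hsep, nearOrbit_of_certificate r c b η γ A x y ζ₀ htrial hdich, hgap⟩

end Certificate

end Summit.QuantumFields.YangMills.Cruxes.NT.ClassicalShadow

end
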